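import Summits.KontsevichZagierPeriods.KontsevichZagierPeriods.Theorems.SymplecticScissorsRealOnePeriodRelationsStubTorsUnitSigma
import Literature.NumberTheory.Transcendental.CurvePeriodsEllipticTranslationProofs

/-!
# Crux `RealOnePeriodRelations` (stmt-KontsevichZagierPeriods-10042), line `nash-retraction-thin-strip`, reshape 10:
# a polynomial with the divisor of the `σ`-quotient IS the `σ`-quotient (towards the lead's stub `stub_torsUnit`)

Let `G ∈ ℂ[x, y]` and `h(z) = G(℘ z, ℘′ z/2)` its pull-back along `φ` (analytic off `Λ`, `Λ`-periodic).  If `h` has a pole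
of order `≤ N` at `0` and vanishes to order `≥ N − 1` at a torsion point `v ∉ Λ` (`N v = m ω₁ + n ω₂`), then
`r = h / g_v` (`g_v = sigmaQuot L v N (mη₁ + nη₂)`, the `σ`-quotient of `…StubTorsUnitSigma.lean`) is `Λ`-periodic, analytic off
`Λ ∪ (v + Λ)`, extends across `0`, and has at most a simple pole at `v`; so, GIVEN the elliptic Liouville lemma (the registered stub
`stub_ellipticLiouville`, taken here as a hypothesis `hLiou`), `h = c · g_v` on `ℂ ∖ Λ` (`eval_phi_eq_const_mul_sigmaQuot`), and the
logarithmic derivative of `h` along `φ` is `N (ζ(z − v) − ζ(z)) + η` (`logDeriv_eval_phi_eq`).  Also: analyticity, periodicity and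
the chain rule for `z ↦ G(φ z)` (`analyticAt_eval_phi`, `eval_phi_add_of_mem`, `hasDerivAt_eval_phi`).
[cite: WhittakerWatson1927, §20.12, §20.53] [cite: HuberWustholz2022, §18.1]
-/

noncomputable section

open scoped BigOperators Topology PeriodPair
open Set Filter MvPolynomial Complex
open Literature.NumberTheory.Transcendental Literature.NumberTheory.Transcendental.CurvePeriods
open Literature.NumberTheory.Transcendental.CurvePeriods.Ell

namespace Summit.KontsevichZagierPeriods.SymplecticScissors.RealOnePeriodRelations

namespace TorsionLayer

variable (L : PeriodPair)

/-! ### Analytic facts about `z ↦ G(φ z)` -/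

/-- The coordinates `℘`, `℘′/2` of `φ` are analytic off `Λ`. [folklore] -/
theorem analyticAt_phi {z : ℂ} (hz : z ∉ L.lattice) : ∀ k : Fin 2, AnalyticAt ℂ (fun w => phi L w k) z := by
  rw [Fin.forall_fin_two]
  refine ⟨?_, ?_⟩
  · simpa [phi] using L.analyticOnNhd_weierstrassP z hz
  · have h := L.analyticOnNhd_derivWeierstrassP z hz
    have e : (fun w => phi L w 1) = fun w => ℘'[L] w * (2 : ℂ)⁻¹ := by
      funext w; simp only [phi_apply_one, div_eq_mul_inv]
    rw [e]
    exact h.mul analyticAt_const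

/-- **`z ↦ G(φ z)` is analytic off `Λ`.** [folklore] -/
theorem analyticAt_eval_phi (G : MvPolynomial (Fin 2) ℂ) {z : ℂ} (hz : z ∉ L.lattice) :
    AnalyticAt ℂ (fun w => eval (phi L w) G) z := by
  induction G using MvPolynomial.induction_on with
  | C a => simpa using analyticAt_const
  | add p q hp hq =>
    have e : (fun w => eval (phi L w) (p + q)) = (fun w => eval (phi L w) p) + fun w => eval (phi L w) q := by
      funext w; simp [map_add]
    rw [e]
    exact hp.add hq
  | mul_X p k hp =>
    have e : (fun w => eval (phi L w) (p * X k)) = (fun w => eval (phi L w) p) * fun w => phi L w k := by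
      funext w; simp [map_mul]
    rw [e]
    exact hp.mul (analyticAt_phi L hz k)

/-- **`Λ`-periodicity**: `G(φ(z + l)) = G(φ z)` for `l ∈ Λ`. [folklore] -/
theorem eval_phi_add_of_mem : ∀ (L : PeriodPair) (G : MvPolynomial (Fin 2) ℂ) (z : ℂ) {l : ℂ}, l ∈ L.lattice → eval (phi L (z + l)) G = eval (phi L z) G := by
  intro L G z l hl
  rw [phi_add_of_mem L z hl]

/-- **Chain rule along `φ`**: `d/dz G(φ z) = Σₖ (∂ₖG)(φ z) φ′ₖ(z)` for `z ∉ Λ`. [folklore] -/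
theorem hasDerivAt_eval_phi (G : MvPolynomial (Fin 2) ℂ) {z : ℂ} (hz : z ∉ L.lattice) :
    HasDerivAt (fun w => eval (phi L w) G) (∑ k, eval (phi L z) (pderiv k G) * phiD L z k) z := by
  have hγ := hasDerivAt_phi L hz
  induction G using MvPolynomial.induction_on with
  | C a =>
    simp only [eval_C, pderiv_C, map_zero, zero_mul, Finset.sum_const_zero]
    exact hasDerivAt_const z a
  | add p q hp hq =>
    have h := hp.add hq
    simp only [map_add, add_mul, Finset.sum_add_distrib]
    exact h
  | mul_X p i hp =>
    have h := hp.mul (hγ i)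
    have key : ∀ k, eval (phi L z) (pderiv k (p * X i)) * phiD L z k =
        eval (phi L z) (pderiv k p) * phiD L z k * phi L z i +
          (if k = i then eval (phi L z) p * phiD L z i else 0) := by
      intro k
      rw [pderiv_mul, map_add, map_mul, map_mul, eval_X]
      by_cases hk : k = i
      · subst hk
        rw [pderiv_X_self, map_one, if_pos rfl]
        ring
      · rw [pderiv_X_of_ne (fun h => hk h.symm), map_zero, if_neg hk]
        ring
    have hsum : (∑ k, eval (phi L z) (pderiv k (p * X i)) * phiD L z k) =
        (∑ k, eval (phi L z) (pderiv k p) * phiD L z k) * phi L z i + eval (phi L z) p * phiD L z i := by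
      rw [Finset.sum_congr rfl fun k _ => key k, Finset.sum_add_distrib, Finset.sum_mul,
        Finset.sum_ite_eq' Finset.univ i, if_pos (Finset.mem_univ _)]
    have e : (fun w => eval (phi L w) (p * X i)) = (fun w => eval (phi L w) p) * fun w => phi L w i := by
      funext w; simp [map_mul]
    rw [hsum, e]
    exact h

/-! ### The comparison with the `σ`-quotient -/

/-- Points of `v + Λ` other than `z` stay away from `z`: eventually along `𝓝[≠] z`, `w − v ∉ Λ`. [folklore] -/
theorem eventually_sub_notMem (v z : ℂ) : ∀ᶠ w in 𝓝[≠] z, w - v ∉ L.lattice := by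
  have h := L.compl_lattice_sdiff_singleton_mem_nhds (z - v)
  have hc : Tendsto (fun w : ℂ => w - v) (𝓝 z) (𝓝 (z - v)) := (continuous_id.sub continuous_const).tendsto z
  have h1 : ∀ᶠ w in 𝓝 z, w - v ∈ ((L.lattice : Set ℂ) \ {z - v})ᶜ := hc.eventually (Filter.eventually_mem_set.2 h) |>.mono
    (fun w hw => hw)
  rw [eventually_nhdsWithin_iff]
  filter_upwards [h1] with w hw hwz
  intro hmem
  apply hw
  refine ⟨hmem, fun h => hwz ?_⟩
  have : w - v = z - v := h
  simpa using congrArg (· + v) this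

/-- Eventually along `𝓝 z` (`z ∉ Λ`), `w ∉ Λ`. [folklore] -/
theorem eventually_notMem {z : ℂ} (hz : z ∉ L.lattice) : ∀ᶠ w in 𝓝 z, w ∉ L.lattice :=
  L.isClosed_lattice.isOpen_compl.mem_nhds hz

/-- `sigmaQuot` is analytic off `Λ`. [folklore] -/
theorem analyticAt_sigmaQuot (v : ℂ) (N : ℕ) (η : ℂ) {z : ℂ} (hz : z ∉ L.lattice) :
    AnalyticAt ℂ (sigmaQuot L v N η) z := by
  unfold sigmaQuot
  have hσ : AnalyticAt ℂ (fun w => L.weierstrassSigma (w - v)) z :=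
    (L.differentiable_weierstrassSigma_holds.comp (differentiable_id.sub_const v)).analyticAt z
  exact ((hσ.div (analyticAt_weierstrassSigma L z) (L.weierstrassSigma_ne_zero hz)).pow N).mul
    ((analyticAt_const.mul analyticAt_id).cexp)

/-- **A polynomial with the divisor of the `σ`-quotient is a constant multiple of it** (given the elliptic Liouville lemma as the
hypothesis `hLiou`): if `h = G ∘ φ` has a pole of order `≤ N` at `0` and vanishes to order `≥ N − 1` at the torsion point `v`
(`N v = m ω₁ + n ω₂`, `η = m η₁ + n η₂`), then `h = c · sigmaQuot L v N η` on `ℂ ∖ Λ`. [cite: WhittakerWatson1927, §20.12, §20.53] -/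
theorem eval_phi_eq_const_mul_sigmaQuot {v : ℂ} (hv : v ∉ L.lattice) {N : ℕ} (hN : 1 ≤ N) {m n : ℤ}
    (hNv : (N : ℂ) * v = m * L.ω₁ + n * L.ω₂) {η : ℂ} (hη : η = m * L.η₁ + n * L.η₂) (G : MvPolynomial (Fin 2) ℂ)
    (hF : ∃ F : ℂ → ℂ, AnalyticAt ℂ F 0 ∧ ∀ᶠ z in 𝓝[≠] (0 : ℂ), eval (phi L z) G = F z / z ^ N)
    (hq : ∃ q : ℂ → ℂ, AnalyticAt ℂ q v ∧ ∀ᶠ z in 𝓝 v, eval (phi L z) G = (z - v) ^ (N - 1) * q z)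
    (hLiou : ∀ r : ℂ → ℂ,
      (∀ z : ℂ, z ∉ L.lattice → (∀ l ∈ L.lattice, z ≠ v + l) → AnalyticAt ℂ r z) →
      (∀ z : ℂ, z ∉ L.lattice → (∀ l ∈ L.lattice, z ≠ v + l) → r (z + L.ω₁) = r z) →
      (∀ z : ℂ, z ∉ L.lattice → (∀ l ∈ L.lattice, z ≠ v + l) → r (z + L.ω₂) = r z) →
      (∃ F₀ : ℂ → ℂ, AnalyticAt ℂ F₀ 0 ∧ ∀ᶠ z in 𝓝[≠] (0 : ℂ), r z = F₀ z) →
      (∃ F : ℂ → ℂ, AnalyticAt ℂ F v ∧ ∀ᶠ z in 𝓝[≠] v, r z = F z / (z - v)) →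
      ∃ c : ℂ, ∀ z : ℂ, z ∉ L.lattice → (∀ l ∈ L.lattice, z ≠ v + l) → r z = c) :
    ∃ c : ℂ, ∀ z : ℂ, z ∉ L.lattice → eval (phi L z) G = c * sigmaQuot L v N η z := by
  set g := sigmaQuot L v N η with hg
  set h : ℂ → ℂ := fun z => eval (phi L z) G with hh
  -- the bad set `v + Λ` in the form `z - v ∈ Λ`
  have bad_iff : ∀ z : ℂ, (∀ l ∈ L.lattice, z ≠ v + l) ↔ z - v ∉ L.lattice := by
    intro z
    constructor
    · intro hl hmem
      exact hl (z - v) hmem (by ring)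
    · intro hzv l hl hzl
      apply hzv
      rw [hzl]; simpa using hl
  set r : ℂ → ℂ := fun z => h z / g z with hr
  -- (1) analyticity of `r` off the bad set
  have hana : ∀ z : ℂ, z ∉ L.lattice → (∀ l ∈ L.lattice, z ≠ v + l) → AnalyticAt ℂ r z := by
    intro z hz hzv
    rw [bad_iff] at hzv
    exact (analyticAt_eval_phi L G hz).div (analyticAt_sigmaQuot L v N η hz) (sigmaQuot_ne_zero L v N η hz hzv)
  -- (2) periodicity
  have hper₁ : ∀ z : ℂ, z ∉ L.lattice → (∀ l ∈ L.lattice, z ≠ v + l) → r (z + L.ω₁) = r z := by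
    intro z _ _
    simp only [hr, hh, hg]
    rw [eval_phi_add_of_mem L G z L.ω₁_mem_lattice, sigmaQuot_add_ω₁ L hNv hη]
  have hper₂ : ∀ z : ℂ, z ∉ L.lattice → (∀ l ∈ L.lattice, z ≠ v + l) → r (z + L.ω₂) = r z := by
    intro z _ _
    simp only [hr, hh, hg]
    rw [eval_phi_add_of_mem L G z L.ω₂_mem_lattice, sigmaQuot_add_ω₂ L hNv hη]
  -- (3) removable at `0`
  have hrem : ∃ F₀ : ℂ → ℂ, AnalyticAt ℂ F₀ 0 ∧ ∀ᶠ z in 𝓝[≠] (0 : ℂ), r z = F₀ z := by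
    obtain ⟨F, hFan, hFev⟩ := hF
    obtain ⟨F₁, hF₁an, hF₁0, hF₁⟩ := sigmaQuot_eq_div_pow_near_zero L hv N η
    refine ⟨fun z => F z / F₁ z, hFan.div hF₁an hF₁0, ?_⟩
    filter_upwards [hFev, self_mem_nhdsWithin] with z hz hz0
    simp only [hr, hh, hg]
    rw [hz, hF₁ z hz0]
    have hzN : z ^ N ≠ 0 := pow_ne_zero _ hz0
    field_simp
  -- (4) at most a simple pole at `v`
  have hpole : ∃ F : ℂ → ℂ, AnalyticAt ℂ F v ∧ ∀ᶠ z in 𝓝[≠] v, r z = F z / (z - v) := by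
    obtain ⟨q, hqan, hqev⟩ := hq
    obtain ⟨u, huan, huv, hu⟩ := sigmaQuot_eq_pow_mul L hv N η
    refine ⟨fun z => q z / u z, hqan.div huan huv, ?_⟩
    have hu_ne : ∀ᶠ z in 𝓝 v, u z ≠ 0 := huan.continuousAt.eventually_ne huv
    have hq' : ∀ᶠ z in 𝓝[≠] v, eval (phi L z) G = (z - v) ^ (N - 1) * q z := mem_nhdsWithin_of_mem_nhds hqev
    filter_upwards [hq', mem_nhdsWithin_of_mem_nhds hu_ne, self_mem_nhdsWithin] with z hz huz hzv
    simp only [hr, hh, hg]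
    rw [hz, hu z]
    have hzv' : z - v ≠ 0 := sub_ne_zero.2 hzv
    obtain ⟨k, rfl⟩ := Nat.exists_eq_add_of_le hN
    simp only [Nat.add_sub_cancel_left, pow_succ, pow_add]
    field_simp
  obtain ⟨c, hc⟩ := hLiou r hana hper₁ hper₂ hrem hpole
  refine ⟨c, fun z hz => ?_⟩
  by_cases hzv : z - v ∈ L.lattice
  · -- on `v + Λ` both sides vanish: `g z = 0`, and `h z = c g z` by continuity from the punctured neighbourhood
    have hgz : g z = 0 := by
      simp only [hg, sigmaQuot]
      rw [(L.weierstrassSigma_eq_zero_iff_holds (z - v)).2 hzv]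
      simp [zero_pow (by omega : N ≠ 0)]
    have hev : ∀ᶠ w in 𝓝[≠] z, h w = c * g w := by
      filter_upwards [eventually_sub_notMem L v z, mem_nhdsWithin_of_mem_nhds (eventually_notMem L hz)] with w hwv hw
      have hrw := hc w hw ((bad_iff w).2 hwv)
      simp only [hr] at hrw
      have hgw : g w ≠ 0 := sigmaQuot_ne_zero L v N η hw hwv
      rw [← hrw]
      field_simp
    have hlim1 : Tendsto h (𝓝[≠] z) (𝓝 (h z)) :=
      ((analyticAt_eval_phi L G hz).continuousAt.tendsto).mono_left nhdsWithin_le_nhds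
    have hlim2 : Tendsto (fun w => c * g w) (𝓝[≠] z) (𝓝 (c * g z)) :=
      (((analyticAt_sigmaQuot L v N η hz).continuousAt.tendsto).mono_left nhdsWithin_le_nhds).const_mul c
    have heq := tendsto_nhds_unique (hlim1.congr' hev) hlim2
    simpa [hh] using heq
  · have hrz := hc z hz ((bad_iff z).2 hzv)
    simp only [hr] at hrz
    have hgz : g z ≠ 0 := sigmaQuot_ne_zero L v N η hz hzv
    rw [← hrz]
    simp only [hh]
    field_simp

/-- **The logarithmic derivative of `h = c · g_v` along `φ`**: for `z ∉ Λ`, `z − v ∉ Λ` and `c ≠ 0`,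
`(Σₖ (∂ₖG)(φ z) φ′ₖ z) / G(φ z) = N (ζ(z − v) − ζ(z)) + η`. [cite: WhittakerWatson1927, §20.53] -/
theorem logDeriv_eval_phi_eq {v : ℂ} {N : ℕ} {η c : ℂ} (hc : c ≠ 0) (G : MvPolynomial (Fin 2) ℂ)
    (hG : ∀ z : ℂ, z ∉ L.lattice → eval (phi L z) G = c * sigmaQuot L v N η z)
    {z : ℂ} (hz : z ∉ L.lattice) (hzv : z - v ∉ L.lattice) :
    (∑ k, eval (phi L z) (pderiv k G) * phiD L z k) / eval (phi L z) G =
      N * (L.weierstrassZeta (z - v) - L.weierstrassZeta z) + η := by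
  have h1 := hasDerivAt_eval_phi L G hz
  have h2 : HasDerivAt (fun w => eval (phi L w) G)
      (c * (sigmaQuot L v N η z * (N * (L.weierstrassZeta (z - v) - L.weierstrassZeta z) + η))) z := by
    have h := (hasDerivAt_sigmaQuot L v N η hz hzv).const_mul c
    refine h.congr_of_eventuallyEq ?_
    filter_upwards [eventually_notMem L hz] with w hw
    exact hG w hw
  have heq := h1.unique h2
  rw [heq, hG z hz]
  have hg : sigmaQuot L v N η z ≠ 0 := sigmaQuot_ne_zero L v N η hz hzv
  field_simp

end TorsionLayer

end Summit.KontsevichZagierPeriods.SymplecticScissors.RealOnePeriodRelations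

end
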